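import Literature.AnabelianGeometry.AbsoluteAnabelian.AbsTopII.DehnTwistLoopLogPoints
import HarnessLib

/-!
# [AbsTopII] Prop 1.3 (x) at the nodal datum: the CUSP clause fires too (all three kinds at ONE datum with a node)

S. Mochizuki, *Topics in Absolute Anabelian Geometry II* [AbsTopII] (bib `MochizukiAbsTopII2013`; locators =
PDF pages of the kurims manuscript `paper:url-585b8d0ad0d9`), §1, Def 1.2 (ii) p. 10, Prop 1.3 (x) p. 12:

> "(x) [...] Let us call `τ_I` non-verticial (respectively, non-edge-like) if `τ_I(I)` is not contained in `I_v`
> (respectively, `I_e`) for any vertex `v` (respectively, edge `e`) of `𝔾`.  Then if `τ_I` is non-verticial and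
> non-edge-like, then the image of `τ_S` is the unique cusp `e_τ` of `X` such that [for an appropriate choice of
> conjugate of `D_{e_τ}`] `τ_I(I) ⊆ D_{e_τ}`."

PROOF-ONLY sequel (abc-iut-L4-t6 lineage, row «P13x″-NODAL-LOGPOINTS») of `DehnTwistLoopLogPoints.lean` (where
`DPSCIndexData.Prop_1_3_x''` was shown to HOLD at the nodal Dehn-twist datum `DehnTwist.dpsc i hi` and its NODE
clause to fire).  Here: the CUSP members of the family `logPoints i hi` — the conjugates of the slope-`n` sections
`U_n = {(c^{k^n}, k)}` along the commutator axis — are NON-VERTICIAL and NON-EDGE-LIKE whenever `i ∤ n` (in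
particular `n = 1`, `i ≥ 2`), so the hypotheses of the cusp clause of (x) are MET (not merely its conclusion): at
ONE datum WITH A NODE all three kinds of log points (smooth / node / cusp) occur with their characteristic clause of
Prop 1.3 (x) firing (`exists_nodal_model_prop_1_3_x''_all_fire`).

Mechanism: the map `x ↦ ĥ_i(x.left)`, `Π_I = F̂₂ ⋊_{shear^i} Ẑ → Heis(ℤ/i)`, is MULTIPLICATIVE (`hHat_left_mul`;
twist-invariance of L2's Heisenberg level map `ĥ_i`, `hHat_shearPow`), so it turns conjugates in `Π_I` into
conjugates in `Heis(ℤ/i)`; `ĥ_i(c^{ι(1)^n}) = (0, 0, n mod i)` is central and non-zero for `i ∤ n`, while the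
`ĥ_i`-images of `I_v`, `I_e = b^Ẑ ⋊ Ẑ`, `I_c = Π_c × 1` are `1`, `{(0, t, 0)}` (whose conjugates `(0, t, Xt)`
have vanishing `z` when `y = 0`), and a subgroup of `Π_𝔾` (killed by the section property) respectively.
HONEST FRAMING: constructed ≠ geometric; an instance at a constructed datum, not the printed theorem for stable log
curves; for `i ∣ n` (e.g. every cusp member when `i = 1`) non-verticiality is NOT claimed here (the `ĥ_i`
invariant is blind to it); nothing here bears on [IUTchIII] Cor 3.12.
-/

noncomputable section

open scoped Pointwise

namespace Literature.AnabelianGeometry.AbsoluteAnabelian.AbsTopII.DehnTwist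

open Literature.AnabelianGeometry.EtaleTheta.SettingModel
open _root_.Topology

variable (i : ℕ)

/-! ### `x ↦ ĥ_i(x.left)` is a homomorphism on `Π_I` -/

/-- **`ĥ_i((x·y).left) = ĥ_i(x.left) · ĥ_i(y.left)`** (`(x·y).left = x.left · shear(y.left)` and `ĥ_i` is
twist-invariant). [cite: MochizukiAbsTopII2013, Prop 1.3 (x) p.12] -/
theorem hHat_left_mul (hi : 0 < i) (x y : Ext i) :
    hHat ⟨i, hi⟩ (x * y).left = hHat ⟨i, hi⟩ x.left * hHat ⟨i, hi⟩ y.left := by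
  rw [SemidirectProduct.mul_left, map_mul, hHat_shearPow i hi]

/-- `ĥ_i((x⁻¹).left) = ĥ_i(x.left)⁻¹`. [cite: MochizukiAbsTopII2013, Prop 1.3 (x) p.12] -/
theorem hHat_left_inv (hi : 0 < i) (x : Ext i) : hHat ⟨i, hi⟩ x⁻¹.left = (hHat ⟨i, hi⟩ x.left)⁻¹ := by
  rw [SemidirectProduct.inv_left, hHat_shearPow i hi, map_inv]

/-- **Conjugates go to conjugates**: if `x ∈ g S g⁻¹` then `ĥ_i(x.left) = ĥ_i(g.left) · ĥ_i(s.left) · ĥ_i(g.left)⁻¹`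
for some `s ∈ S`. [cite: MochizukiAbsTopII2013, Prop 1.3 (x) p.12] -/
theorem exists_hHat_left_eq_conj_of_mem_conj_smul (hi : 0 < i) {S : Subgroup (Ext i)} {g x : Ext i}
    (hx : x ∈ MulAut.conj g • S) :
    ∃ s ∈ S, hHat ⟨i, hi⟩ x.left = hHat ⟨i, hi⟩ g.left * hHat ⟨i, hi⟩ s.left * (hHat ⟨i, hi⟩ g.left)⁻¹ := by
  rw [Subgroup.mem_smul_pointwise_iff_exists] at hx
  obtain ⟨s, hs, rfl⟩ := hx
  exact ⟨s, hs, by rw [MulAut.smul_def, MulAut.conj_apply, hHat_left_mul i hi, hHat_left_mul i hi,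
    hHat_left_inv i hi]⟩

/-! ### The cusp sections `U_n`, `i ∤ n`, are non-verticial and non-edge-like -/

/-- The test element `(c^{ι(1)^n}, ι(1)) ∈ U_n` has `ĥ_i`-value `(0, 0, n mod i)`.
[cite: MochizukiAbsTopII2013, Prop 1.3 (x) p.12] -/
theorem hHat_left_cuspSlopeSection_iotaZ_one (hi : 0 < i) (n : ℕ) :
    hHat ⟨i, hi⟩ (cuspSlopeSection i n (iotaZ (Multiplicative.ofAdd 1))).left = ⟨0, 0, (n : ZMod i)⟩ := by
  rw [cuspSlopeSection_apply, left_inl_mul_inr]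
  exact hHat_cPow_iotaZ_one_pow ⟨i, hi⟩ n

/-- `n mod i ≠ 0` in `ℤ/i` when `i ∤ n`. [cite: MochizukiAbsTopII2013, Ex 1.1 (iii) p.9] -/
theorem natCast_zmod_ne_zero_of_not_dvd {n : ℕ} (hin : ¬ i ∣ n) : (n : ZMod i) ≠ 0 := fun h =>
  hin ((ZMod.natCast_eq_zero_iff n i).mp h)

/-- **`U_n ⊄ γ I_v γ⁻¹`** (`i ∤ n`): conjugates of `I_v = 1 ⋊ Ẑ` are `ĥ_i`-invisible, the test element is not.
[cite: MochizukiAbsTopII2013, Prop 1.3 (x) p.12] -/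
theorem not_range_cuspSlopeSection_le_conj_smul_range_inr (hi : 0 < i) {n : ℕ} (hin : ¬ i ∣ n) (γ : Ext i) :
    ¬ (cuspSlopeSection i n).range ≤ MulAut.conj γ • (SemidirectProduct.inr : ZH →* Ext i).range := by
  intro hle
  have h1 := hHat_left_eq_one_of_mem_conj_smul_range_inr i hi (hle ⟨iotaZ (Multiplicative.ofAdd 1), rfl⟩)
  rw [hHat_left_cuspSlopeSection_iotaZ_one] at h1
  exact natCast_zmod_ne_zero_of_not_dvd i hin (congrArg Heis.z h1)

/-- **`U_n ⊄ γ I_e γ⁻¹`** (`i ∤ n`), `I_e = Z_{Π_I}(Π_e × 1) = b^Ẑ ⋊ Ẑ`: the `ĥ_i`-image of `I_e` is `{(0, t, 0)}`, a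
conjugate of which is `(0, t, X·t)` — vanishing `y` forces vanishing `z`, but the test element is `(0, 0, n mod i)`.
[cite: MochizukiAbsTopII2013, Prop 1.3 (x) p.12] -/
theorem not_range_cuspSlopeSection_le_conj_smul_IvNode (hi : 0 < i) {n : ℕ} (hin : ¬ i ∣ n) (γ : Ext i) :
    ¬ (cuspSlopeSection i n).range ≤ MulAut.conj γ •
      (Subgroup.centralizer ((nodeGp.map (SemidirectProduct.inl : F₂hatT →* Ext i) : Subgroup (Ext i)) :
          Set (Ext i)) ⊓ (⊤ : Subgroup (Ext i))) := by
  intro hle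
  obtain ⟨s, hs, hconj⟩ := exists_hHat_left_eq_conj_of_mem_conj_smul i hi (hle ⟨iotaZ (Multiplicative.ofAdd 1), rfl⟩)
  have hZ : Subgroup.centralizer (nodeGp : Set F₂hatT) = nodeGp := centralizer_bAxis_eq
  rw [mem_centralizer_node_inf_top_iff, hZ] at hs
  obtain ⟨t, ht⟩ := hs
  have ht' : s.left = bPow t := ht.symm
  rw [hHat_left_cuspSlopeSection_iotaZ_one, ht', hHat_bPow] at hconj
  -- compare the `y`- and `z`-coordinates of `(0,0,n̄) · ĥ(g) = ĥ(g) · (0, t̄, 0)`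
  have E := eq_mul_inv_iff_mul_eq.mp hconj
  have hy := congrArg Heis.y E
  have hz := congrArg Heis.z E
  simp only [Heis.mul_y, Heis.mul_z, zero_add, add_zero, zero_mul] at hy hz
  -- `hy : ĥ(g).y = ĥ(g).y + t̄`, `hz : n̄ + ĥ(g).z = ĥ(g).z + ĥ(g).x * t̄`
  have ht0 : Multiplicative.toAdd (EtaleTheta.ZHatLevel.level ⟨i, hi⟩ t) = 0 := by
    have := hy
    rw [eq_comm, add_eq_left] at this
    exact this
  rw [ht0, mul_zero, add_zero, add_eq_right] at hz
  exact natCast_zmod_ne_zero_of_not_dvd i hin hz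

/-- `ι(1) ≠ 1` in `Ẑ` (`b^{ι(1)} = η b ≠ 1`). [cite: MochizukiAbsTopII2013, Ex 1.1 (iii) p.9] -/
theorem iotaZ_one_ne_one : iotaZ (Multiplicative.ofAdd 1) ≠ (1 : ZH) := fun h =>
  eta_one_ne_one (by rw [← bPow_iotaZ_one, h, map_one])

/-- **`U_n ⊄ γ I_c γ⁻¹`** for the cusp inertia `I_c = Π_c × 1 ≤ Π_𝔾`: a conjugate of `I_c` lies in the normal
subgroup `Π_𝔾 = F̂₂ × 1`, but `U_n` has the element `(c^{ι(1)^n}, ι(1))` with `ι(1) ≠ 1`.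
[cite: MochizukiAbsTopII2013, Prop 1.3 (x) p.12] -/
theorem not_range_cuspSlopeSection_le_conj_smul_of_le_range_inl (n : ℕ) {S : Subgroup (Ext i)}
    (hS : S ≤ (SemidirectProduct.inl : F₂hatT →* Ext i).range) (γ : Ext i) :
    ¬ (cuspSlopeSection i n).range ≤ MulAut.conj γ • S := by
  haveI := normal_range_inl i
  intro hle
  have hle' : (cuspSlopeSection i n).range ≤ (SemidirectProduct.inl : F₂hatT →* Ext i).range := by
    refine le_trans hle ?_
    rw [← Subgroup.Normal.conj_smul_eq_self γ (SemidirectProduct.inl : F₂hatT →* Ext i).range]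
    exact Subgroup.pointwise_smul_le_pointwise_smul_iff.mpr hS
  obtain ⟨m, hm⟩ := hle' ⟨iotaZ (Multiplicative.ofAdd 1), rfl⟩
  have h := congrArg SemidirectProduct.right hm
  rw [SemidirectProduct.right_inl, cuspSlopeSection_apply, right_inl_mul_inr] at h
  exact iotaZ_one_ne_one h.symm

/-- Conjugated form: `δ U_n δ⁻¹ ⊄ γ I_v γ⁻¹` (`i ∤ n`). [cite: MochizukiAbsTopII2013, Prop 1.3 (x) p.12] -/
theorem not_conj_smul_range_cuspSlopeSection_le_conj_smul_range_inr (hi : 0 < i) {n : ℕ} (hin : ¬ i ∣ n)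
    (δ γ : Ext i) :
    ¬ MulAut.conj δ • (cuspSlopeSection i n).range ≤
      MulAut.conj γ • (SemidirectProduct.inr : ZH →* Ext i).range := by
  rw [Subgroup.pointwise_smul_subset_iff, smul_smul, ← map_inv, ← map_mul]
  exact not_range_cuspSlopeSection_le_conj_smul_range_inr i hi hin _

/-- Conjugated form: `δ U_n δ⁻¹ ⊄ γ I_e γ⁻¹` (`i ∤ n`). [cite: MochizukiAbsTopII2013, Prop 1.3 (x) p.12] -/
theorem not_conj_smul_range_cuspSlopeSection_le_conj_smul_IvNode (hi : 0 < i) {n : ℕ} (hin : ¬ i ∣ n)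
    (δ γ : Ext i) :
    ¬ MulAut.conj δ • (cuspSlopeSection i n).range ≤ MulAut.conj γ •
      (Subgroup.centralizer ((nodeGp.map (SemidirectProduct.inl : F₂hatT →* Ext i) : Subgroup (Ext i)) :
          Set (Ext i)) ⊓ (⊤ : Subgroup (Ext i))) := by
  rw [Subgroup.pointwise_smul_subset_iff, smul_smul, ← map_inv, ← map_mul]
  exact not_range_cuspSlopeSection_le_conj_smul_IvNode i hi hin _

/-- Conjugated form: `δ U_n δ⁻¹ ⊄ γ S γ⁻¹` for `S ≤ Π_𝔾`. [cite: MochizukiAbsTopII2013, Prop 1.3 (x) p.12] -/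
theorem not_conj_smul_range_cuspSlopeSection_le_conj_smul_of_le_range_inl (n : ℕ) {S : Subgroup (Ext i)}
    (hS : S ≤ (SemidirectProduct.inl : F₂hatT →* Ext i).range) (δ γ : Ext i) :
    ¬ MulAut.conj δ • (cuspSlopeSection i n).range ≤ MulAut.conj γ • S := by
  rw [Subgroup.pointwise_smul_subset_iff, smul_smul, ← map_inv, ← map_mul]
  exact not_range_cuspSlopeSection_le_conj_smul_of_le_range_inl i n hS _

/-! ### The cusp members of `logPoints i hi` -/

section Members

variable {i} (hi : 0 < i)

/-- **The cusp member `(δ, n)` is NON-VERTICIAL when `i ∤ n`.** [cite: MochizukiAbsTopII2013, Prop 1.3 (x) p.12] -/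
theorem isNonVerticial_logPoints_cusp (δ : Ext i) (n : ℕ) (hn : 0 < n) (hin : ¬ i ∣ n) :
    (logPoints i hi (LogPt.cusp δ n hn)).IsNonVerticial := by
  intro v g
  rw [logPoints_cusp_image, Iv_dpsc_eq_range_inr_holds]
  exact not_conj_smul_range_cuspSlopeSection_le_conj_smul_range_inr i hi hin δ g

/-- **The cusp member `(δ, n)` is NON-EDGE-LIKE when `i ∤ n`** (neither in a conjugate of `I_e` — the `ĥ_i`
argument — nor in a conjugate of `I_c ≤ Π_𝔾` — the section argument). [cite: MochizukiAbsTopII2013, Prop 1.3 (x) p.12] -/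
theorem isNonEdgeLike_logPoints_cusp (δ : Ext i) (n : ℕ) (hn : 0 < n) (hin : ¬ i ∣ n) :
    (logPoints i hi (LogPt.cusp δ n hn)).IsNonEdgeLike := by
  intro e g
  rcases e with e | c
  · change ¬ _ ≤ MulAut.conj g • (dpsc i hi).IvNode e
    rw [logPoints_cusp_image, dpsc_IvNode]
    exact not_conj_smul_range_cuspSlopeSection_le_conj_smul_IvNode i hi hin δ g
  · change ¬ _ ≤ MulAut.conj g • (dpsc i hi).IvCusp c
    rw [logPoints_cusp_image, dpsc_IvCusp]
    exact not_conj_smul_range_cuspSlopeSection_le_conj_smul_of_le_range_inl i n (Subgroup.map_le_range _ _) δ g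

/-- **The cusp clause of Prop 1.3 (x) FIRES at the nodal datum** (`i ∤ n`, e.g. `n = 1`, `i ≥ 2`): the member
`(δ, n)` is non-verticial AND non-edge-like (the clause's hypotheses), is labelled by the cusp, and its section lies
in a `Π_𝔾`-conjugate of `D_c` (the clause's conclusion). [cite: MochizukiAbsTopII2013, Prop 1.3 (x) p.12] -/
theorem cusp_clause_fires (δ : Ext i) (n : ℕ) (hn : 0 < n) (hin : ¬ i ∣ n) (c : (dpsc i hi).Cusp) :
    (logPoints i hi (LogPt.cusp δ n hn)).IsNonVerticial ∧ (logPoints i hi (LogPt.cusp δ n hn)).IsNonEdgeLike ∧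
      (logPoints i hi (LogPt.cusp δ n hn)).kind = DPSCIndexData.PointKind.cusp c ∧
      ∃ γ : (dpsc i hi).PiH, γ ∈ (dpsc i hi).PiG ∧
        (logPoints i hi (LogPt.cusp δ n hn)).image ≤ MulAut.conj γ • (dpsc i hi).DvCusp c := by
  obtain ⟨⟨⟩⟩ := c
  exact ⟨isNonVerticial_logPoints_cusp hi δ n hn hin, isNonEdgeLike_logPoints_cusp hi δ n hn hin, rfl,
    exists_image_le_conj_DvCusp_logPoints_cusp hi δ n hn ⟨()⟩⟩

end Members

/-- **At ONE DPSC datum WITH A NODE all three clauses of Prop 1.3 (x) fire** (`i ≥ 2`): `Prop_1_3_x''` holds for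
the family `logPoints`, and there are members at which (a) the smooth clause "`τ_I(I) = I_{v_τ}`" holds with both
sides TRUE, (b) the NODE clause holds with both sides TRUE (non-verticial section inside a conjugate of `I_e`),
(c) the CUSP clause's hypotheses (non-verticial AND non-edge-like) are MET at a cusp-labelled member.  No hypothesis.
[cite: MochizukiAbsTopII2013, Prop 1.3 (x) p.12] -/
theorem exists_nodal_model_prop_1_3_x''_all_fire (i : ℕ) (hi2 : 2 ≤ i) :
    ∃ (X : DPSCIndexData.{0}) (L : Type) (pt : L → X.LogPointData),
      Nonempty X.Node ∧ X.Prop_1_3_x'' pt ∧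
      (∀ v : X.Vert, ∃ l, (pt l).kind = DPSCIndexData.PointKind.smooth v ∧
        ∃ γ : X.PiH, γ ∈ X.PiG ∧ (pt l).image = MulAut.conj γ • X.Iv v) ∧
      (∀ e : X.Node, ∃ l, (pt l).kind = DPSCIndexData.PointKind.node e ∧ (pt l).IsNonVerticial ∧
        ∃ γ : X.PiH, γ ∈ X.PiG ∧ (pt l).image ≤ MulAut.conj γ • X.IvNode e) ∧
      (∀ c : X.Cusp, ∃ l, (pt l).kind = DPSCIndexData.PointKind.cusp c ∧ (pt l).IsNonVerticial ∧
        (pt l).IsNonEdgeLike ∧ ∃ γ : X.PiH, γ ∈ X.PiG ∧ (pt l).image ≤ MulAut.conj γ • X.DvCusp c) := by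
  have hi : 0 < i := by omega
  have h1 : ¬ i ∣ 1 := fun h => by have := Nat.le_of_dvd Nat.one_pos h; omega
  refine ⟨dpsc i hi, LogPt i, logPoints i hi, dpsc_node_nonempty i hi, prop_1_3_x''_dpsc_holds hi,
    fun v => ⟨LogPt.smooth 1, ?_, exists_image_eq_conj_Iv_logPoints_smooth hi 1 v⟩,
    fun e => ⟨LogPt.node 1 1 Nat.one_pos (by omega), node_clause_fires hi (by omega) 1 e⟩,
    fun c => ⟨LogPt.cusp 1 1 Nat.one_pos, ?_⟩⟩
  · obtain ⟨⟨⟩⟩ := v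
    rfl
  · obtain ⟨hnv, hne, hk, hD⟩ := cusp_clause_fires hi 1 1 Nat.one_pos h1 c
    exact ⟨hk, hnv, hne, hD⟩

end Literature.AnabelianGeometry.AbsoluteAnabelian.AbsTopII.DehnTwist

end
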